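import Summits.HodgeConjecture.HodgeConjecture.Theses.PadicSemiregularLift
import Literature.AlgebraicGeometry.HodgeTheory.SemiregularityMap

/-!
# `SemiregularSeedsOnAnchors` (stmt-HodgeConjecture-13941) · Negative · the semiregularity carrier

Negative-side knowledge for the informal crux `PadicSemiregularLift.SemiregularSeedsOnAnchors`
(p-adically semiregular seeds on cohomologically supersingular anchors), extracted from the standing
disprover's work file `Cruxes/SemiregularSeedsOnAnchors/Disproof.lean`
(refuter-cdisprove-stmt-HodgeConjecture-13941-0, cycle 1, 2026-08-15) so that planners typing the crux
and provers attacking it can import them. All statements are unconditional theorems over the tree's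
σ-carrier `Literature.AlgebraicGeometry.HodgeTheory.AtiyahTraceAlgebra` (Buchweitz–Flenner Def. 4.1):

* `not_isSemiregular_killTrace`, `isSemiregular_tautological` — the carrier's trace / product / Atiyah
  class are free data, so semiregularity of a RE-DECORATED algebra is worthless: a closed typing of the
  crux with an ∃-quantified decoration is vacuous, with a ∀-quantified one refutable; the crux needs a
  constructed Atiyah class and Illusie trace (the planner's definition requests) before it can be typed;
* `finrank_ext_le_of_isSemiregular`, `not_isSemiregular_of_lt_finrank_ext` — the forced-kernel
  principle `dim Ext²(E,E) ≤ Σ_q h^{q,q+2}` behind every attack on the crux;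
* `cubicFourfold_finrank_ext_le_one`, `cubicFourfold_isSemiregular_iff` — at a cubic-fourfold anchor
  (`h^{0,2} = h^{2,4} = 0`, `h^{1,3} = 1`) seeds have `ext² ≤ 1` and, if `ext² = 1`, are semiregular iff
  `σ₁ ≠ 0`;
* `injective_transpose_iff_surjective`, `injective_transpose_iff_finrank_range` — the linear algebra of
  "σ = evᵗ ⇒ (semiregular ⇔ dim Ext² = rank(σ ∘ ev))" (refuter g2's Lemma B; Markman, arXiv:2502.03415,
  Lemma 8.3.4), which turns semiregularity on an abelian fourfold into a rank computation on `ch(E)`.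
-/

noncomputable section

namespace Summit.HodgeConjecture.HodgeConjecture.Theorems.SemiregularSeedsOnAnchors.Negative

open Literature.AlgebraicGeometry.HodgeTheory

universe u v

section Redecoration

variable {𝕜 : Type u} [CommRing 𝕜]

/-- Re-decoration 1: the same Atiyah–trace algebra with its trace maps replaced by `0` (all other
fields, in particular `Ext 2 0 = Ext²(E,E)`, unchanged). [cite: BuchweitzFlenner2003, §4 (trace map)] -/
def killTrace (A : AtiyahTraceAlgebra.{u, v} 𝕜) : AtiyahTraceAlgebra.{u, v} 𝕜 :=
  { A with trace := fun _ _ => 0 }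

/-- Every component `σ_k` of the trace-killed algebra vanishes (`σ_k = coeff • Tr ∘ (· * Atᵏ)` and
`Tr = 0`). [cite: BuchweitzFlenner2003, Def. 4.1] -/
theorem semiregularityComponent_killTrace (A : AtiyahTraceAlgebra.{u, v} 𝕜) (k : ℕ) :
    (killTrace A).semiregularityComponent k = 0 := by
  ext x
  have htr : (killTrace A).trace (k + 2) k = 0 := rfl
  rw [AtiyahTraceAlgebra.semiregularityComponent_apply, htr]
  simp

/-- **Junk decoration 1.** Killing the trace of ANY Atiyah–trace algebra with `Ext² ≠ 0` produces a
non-semiregular algebra with the same `Ext`-groups, targets, product and Atiyah class: over the carrier,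
"`E` is semiregular" is a property of the DECORATION, refutable by re-decoration whenever
`Ext²(E,E) ≠ 0`. [folklore] -/
theorem not_isSemiregular_killTrace (A : AtiyahTraceAlgebra.{u, v} 𝕜) [Nontrivial (A.Ext 2 0)] :
    ¬ (killTrace A).IsSemiregular := by
  intro h
  rw [AtiyahTraceAlgebra.isSemiregular_iff] at h
  obtain ⟨x, hx⟩ := exists_ne (0 : A.Ext 2 0)
  exact hx (h x fun k => by rw [semiregularityComponent_killTrace]; rfl)

/-- Re-decoration 2: the tautological Atiyah–trace algebra on a commutative `𝕜`-algebra `S` — every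
`A^{i,j}` and every `H^{i,j}` is `S`, the product is multiplication, the trace is the identity, the
Atiyah class is `1`. [cite: BuchweitzFlenner2003, §4 (algebra A)] -/
def tautological (S : Type v) [CommRing S] [Algebra 𝕜 S] : AtiyahTraceAlgebra.{u, v} 𝕜 where
  Ext := fun _ _ => S
  Coh := fun _ _ => S
  one := 1
  mul := fun _ _ => LinearMap.mul 𝕜 S
  one_mul := fun x => one_mul x
  mul_one := fun x => mul_one x
  mul_assoc := fun _ _ _ _ _ _ _ _ x y z => mul_assoc x y z
  trace := fun _ _ => LinearMap.id
  atiyah := (1 : S)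

/-- **Junk decoration 2.** The tautological algebra on any commutative algebra `S` (all `Ext` and all
targets equal to `S`, trace the identity) is semiregular although its `Ext 2 0 = S` is as large as one
likes: `σ₀ = Tr = id` is injective. So an ∃-quantified decoration makes every sheaf "semiregular".
[folklore] -/
theorem isSemiregular_tautological (S : Type v) [CommRing S] [Algebra 𝕜 S] :
    (tautological (𝕜 := 𝕜) S).IsSemiregular := by
  rw [AtiyahTraceAlgebra.isSemiregular_iff]
  intro x hx
  have h0 := hx 0
  rw [AtiyahTraceAlgebra.semiregularityComponent_zero_apply] at h0
  exact h0

end Redecoration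

section ForcedKernel

variable {K : Type u} [Field K] (A : AtiyahTraceAlgebra.{u, v} K)

/-- A sheaf with `Ext² = 0` is semiregular for free (`σ` is injective on the zero space).
[cite: BuchweitzFlenner2003, §1] -/
theorem isSemiregular_of_subsingleton [Subsingleton (A.Ext 2 0)] : A.IsSemiregular :=
  fun x y _ => Subsingleton.elim x y

/-- The components of `σ` supported on a finite set `S` of form degrees, bundled as one linear map
into the finite product `Π_{k ∈ S} H^{k+2}(X, Λᵏ𝕃)`. [cite: BuchweitzFlenner2003, §5 (I-semiregular)] -/
def sigmaOn (S : Finset ℕ) : A.Ext 2 0 →ₗ[K] ((k : S) → A.Coh (k + 2) k) :=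
  LinearMap.pi fun k => A.semiregularityComponent k

/-- Components of `sigmaOn`. [cite: BuchweitzFlenner2003, Def. 4.1] -/
@[simp]
theorem sigmaOn_apply (S : Finset ℕ) (x : A.Ext 2 0) (k : S) :
    sigmaOn A S x k = A.semiregularityComponent k x :=
  rfl

/-- If every component `σ_k`, `k ∉ S`, vanishes identically (e.g. because its target
`H^{k+2}(X, Ω^k)` is zero), semiregularity is injectivity of the finitely many components `σ_S`
(`I`-semiregularity for `I = S`, BF §5). [cite: BuchweitzFlenner2003, §5 (I-semiregular)] -/
theorem isSemiregular_iff_injective_sigmaOn (S : Finset ℕ)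
    (hS : ∀ k ∉ S, A.semiregularityComponent k = 0) :
    A.IsSemiregular ↔ Function.Injective (sigmaOn A S) := by
  rw [AtiyahTraceAlgebra.isSemiregular_iff, injective_iff_map_eq_zero]
  refine forall_congr' fun x => ⟨fun h hx => h fun k => ?_, fun h hx => h ?_⟩
  · by_cases hk : k ∈ S
    · exact congrFun hx ⟨k, hk⟩
    · rw [hS k hk]; rfl
  · funext k
    exact hx k

/-- **Forced kernel.** If the components outside `S` vanish and the targets `H^{k+2}(X, Ω^k)`,
`k ∈ S`, are finite-dimensional, a semiregular sheaf has
`dim Ext²(E,E) ≤ Σ_{k ∈ S} h^{k,k+2}(X)`; contrapositively `dim Ext²(E,E) > Σ_q h^{q,q+2}` FORCES a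
kernel of `σ`. This is the numerical principle behind every "forced kernel" attack on the crux
(`why_might_fail` of the item; CRUX-ATTACK-g2 §4; Markman arXiv:2502.03415 p. 45 uses it for
`F_d = 𝓘_Z(Θ)`: `ext² = 8d + 2ext¹ − 2` grows with `d`). [folklore] -/
theorem finrank_ext_le_of_isSemiregular (S : Finset ℕ)
    (hS : ∀ k ∉ S, A.semiregularityComponent k = 0)
    [∀ k : S, FiniteDimensional K (A.Coh (k + 2) k)] (h : A.IsSemiregular) :
    Module.finrank K (A.Ext 2 0) ≤ ∑ k ∈ S, Module.finrank K (A.Coh (k + 2) k) := by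
  have hinj := (isSemiregular_iff_injective_sigmaOn A S hS).1 h
  calc Module.finrank K (A.Ext 2 0)
      ≤ Module.finrank K ((k : S) → A.Coh (k + 2) k) :=
        LinearMap.finrank_le_finrank_of_injective hinj
    _ = ∑ k : S, Module.finrank K (A.Coh (k + 2) k) := Module.finrank_pi_fintype K
    _ = ∑ k ∈ S, Module.finrank K (A.Coh (k + 2) k) :=
        Finset.sum_coe_sort S (fun k => Module.finrank K (A.Coh (k + 2) k))

/-- Contrapositive form: too many obstructions, too few Hodge targets ⇒ not semiregular. [folklore] -/
theorem not_isSemiregular_of_lt_finrank_ext (S : Finset ℕ)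
    (hS : ∀ k ∉ S, A.semiregularityComponent k = 0)
    [∀ k : S, FiniteDimensional K (A.Coh (k + 2) k)] [FiniteDimensional K (A.Ext 2 0)]
    (hlt : ∑ k ∈ S, Module.finrank K (A.Coh (k + 2) k) < Module.finrank K (A.Ext 2 0)) :
    ¬ A.IsSemiregular :=
  fun h => (Nat.lt_irrefl _) (lt_of_le_of_lt (finrank_ext_le_of_isSemiregular A S hS h) hlt)

end ForcedKernel

section CubicFourfold

/-! ### (b) Tightest honest anchor: the cubic fourfold (`τ = 1`)

For a smooth cubic fourfold `X` (any characteristic `p ∤ 3`, `p ≥ 11` at an anchor) the Hodge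
numbers are those of characteristic `0` (Deligne, SGA 7): `h^{0,2} = h^{2,4} = 0`, `h^{1,3} = 1`,
so the target `⊕_q H^{q+2}(X, Ω^q)` of `σ` is ONE-dimensional (`H³(X, Ω¹)`), and only `σ_1`
is non-zero. Consequences recorded below as theorems over the tree's carrier
`AtiyahTraceAlgebra`: a p-adically semiregular sheaf on a cubic-fourfold anchor has
`ext²(E,E) ≤ 1`, and if `ext² = 1` semiregularity is exactly `σ_1 ≠ 0`. (Supersingular cubic
fourfolds — e.g. Fermat with `p ≡ 2 (mod 3)` — ARE anchors: smooth complete intersection ⇒ (ii),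
Shioda–Katsura/Tate ⇒ (i); content lives in `r = 2`, `b_4 = 23`, `Lef² = K h²`.) -/

variable {K : Type u} [Field K] (A : AtiyahTraceAlgebra.{u, v} K)

/-- **Cubic-fourfold forced kernel.** If only `σ_1` can be non-zero (`H²(𝒪) = H⁴(Ω²) = 0`,
`H^{k+2}(Ω^k) = 0` for `k ≥ 3` on a fourfold) and `h^{1,3} = dim H³(X, Ω¹) = 1`, then a semiregular
sheaf has `dim Ext²(E, E) ≤ 1`. So on a cubic-fourfold anchor every seed is either `Ext²`-rigid
(`ext² = 0`, hence — lifting to EVERY lift and Grothendieck existence — `ch₂ ∈ ℚ h²`, useless) or has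
`ext²(E,E) = 1` exactly. [folklore] -/
theorem cubicFourfold_finrank_ext_le_one (hvan : ∀ k ≠ 1, A.semiregularityComponent k = 0)
    [FiniteDimensional K (A.Coh 3 1)] (h31 : Module.finrank K (A.Coh 3 1) = 1)
    (h : A.IsSemiregular) : Module.finrank K (A.Ext 2 0) ≤ 1 := by
  have hS : ∀ k ∉ ({1} : Finset ℕ), A.semiregularityComponent k = 0 := fun k hk =>
    hvan k (by simpa using hk)
  haveI : ∀ k : ({1} : Finset ℕ), FiniteDimensional K (A.Coh (k + 2) k) := fun k => by
    obtain ⟨k, hk⟩ := k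
    simp only [Finset.mem_singleton] at hk
    subst hk
    exact ‹FiniteDimensional K (A.Coh 3 1)›
  have hle := finrank_ext_le_of_isSemiregular A {1} hS h
  simpa [h31] using hle

/-- **Cubic-fourfold semiregularity criterion.** With the same vanishing and `ext²(E,E) = 1`,
`E` is semiregular iff `σ_1 = tr(− ∘ At(E)) : Ext²(E,E) → H³(X, Ω¹)` is non-zero. By
Buchweitz–Flenner Prop. 4.2 (`σ_1(⟨η, At E⟩) = ⟨η, ch₂(E)⟩`) this holds as soon as the Hodge
class `ch₂^{Hdg}(E) ∈ H²(X_k, Ω²)` is not in `k·h²` (the IVHS pairing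
`H¹(T) ⊗ H^{3,1} → H^{2,2}_prim` of a cubic fourfold is an isomorphism `R₃ ⊗ R₀ → R₃` of
Jacobian-ring pieces, in every characteristic `p ≥ 5`): this is how `E_P` (plane bundles,
CRUX-ATTACK §E) and every SIMPLE object of the Kuznetsov component `𝒜_X` (`ext² = hom = 1` by the
Serre functor `S_𝒜 = [2]`, characteristic-free) become seeds. [cite: BuchweitzFlenner2003, Prop. 4.2] -/
theorem cubicFourfold_isSemiregular_iff (hvan : ∀ k ≠ 1, A.semiregularityComponent k = 0)
    [FiniteDimensional K (A.Ext 2 0)] (h1 : Module.finrank K (A.Ext 2 0) = 1) :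
    A.IsSemiregular ↔ A.semiregularityComponent 1 ≠ 0 := by
  constructor
  · intro h hzero
    rw [AtiyahTraceAlgebra.isSemiregular_iff] at h
    have hpos : 0 < Module.finrank K (A.Ext 2 0) := by omega
    obtain ⟨x, hx⟩ := Module.finrank_pos_iff_exists_ne_zero.1 hpos
    refine hx (h x fun k => ?_)
    by_cases hk : k = 1
    · subst hk
      rw [hzero]
      rfl
    · rw [hvan k hk]
      rfl
  · intro hne
    rw [AtiyahTraceAlgebra.isSemiregular_iff]
    intro x hx
    by_contra hx0
    apply hne
    ext y
    obtain ⟨c, rfl⟩ := (finrank_eq_one_iff_of_nonzero' x hx0).1 h1 y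
    rw [map_smul, hx 1, smul_zero]
    rfl

/-- Griffiths' residue count for a smooth cubic `n`-fold (`p ∤ 3`, `p > n + 1`): the primitive Hodge
number `h^{n-q,q}_prim` is the number of square-free monomials of degree `3(q+1) - (n+2)` in `n + 2`
variables (the Jacobian ring of `Σ xᵢ³` is `k[x]/(xᵢ²)`), i.e. `C(n+2, 3q+1-n)` (zero when
`3q + 1 < n`). [folklore: Griffiths 1969; Katz–Deligne SGA 7 for char `p`] -/
def cubicHodgePrim (n q : ℕ) : ℕ :=
  if n ≤ 3 * q + 1 then Nat.choose (n + 2) (3 * q + 1 - n) else 0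

/-- Cubic fourfold: `(h^{4,0}, h^{3,1}, h^{2,2}_prim, h^{1,3}, h^{0,4}) = (0, 1, 20, 1, 0)`; hence the
semiregularity target `τ = h^{0,2} + h^{1,3} + h^{2,4} = 0 + 1 + 0 = 1` used above, and
`dim H¹(T_X) = h^{2,2}_prim = 20`. [folklore: Griffiths residues] -/
theorem cubicFourfold_hodgeNumbers :
    (cubicHodgePrim 4 0, cubicHodgePrim 4 1, cubicHodgePrim 4 2, cubicHodgePrim 4 3,
      cubicHodgePrim 4 4) = (0, 1, 20, 1, 0) := by
  decide

/-- Cubic sixfold (`n = 6`, `r = 3`): `h^{4,2} = 8`, `h^{3,3}_prim = 70`; target `τ = h^{2,4} = 8`.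
Cubic eightfold: `h^{5,3} = 45`; tenfold: `h^{7,3} = 1`, `h^{6,4} = 220`. The cubic fourfold is the
only cubic with a ONE-dimensional target. [folklore: Griffiths residues] -/
theorem cubicHigher_hodgeNumbers :
    (cubicHodgePrim 6 2, cubicHodgePrim 6 3, cubicHodgePrim 8 3, cubicHodgePrim 10 3,
      cubicHodgePrim 10 4) = (8, 70, 45, 1, 220) := by
  decide

/-- Abelian fourfold (the route's first test, CRUX-ATTACK-g2 §4): `h^{a,b} = C(4,a)·C(4,b)`, so the
target has dimension `τ = h^{0,2} + h^{1,3} + h^{2,4} = 6 + 16 + 6 = 28`, against which g2 computed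
the contraction rank `ρ₂ ≤ 24` on the forced family. [folklore] -/
theorem abelianFourfold_target :
    Nat.choose 4 0 * Nat.choose 4 2 + Nat.choose 4 1 * Nat.choose 4 3 +
      Nat.choose 4 2 * Nat.choose 4 4 = 28 := by
  decide


end CubicFourfold

section TransposeCriterion

/-! ### (a′) The criterion behind every rank computation: `σ = evᵗ`

On an anchor with trivial canonical bundle (abelian fourfolds) Serre duality identifies
`Ext²(E,E) ≅ Ext²(E,E)^∨` and `⊕_q H^{q+2}(Ω^q) ≅ (HT²)^∨`, and under these `σ` is the transpose
of Toda's/Buchweitz–Flenner's evaluation map `ev : HT²(X) → Ext²(E,E)` (CRUX-ATTACK-g2, Lemma B);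
on a cubic fourfold the same holds with `HT²` replaced by `H¹(T_X ⊗ ω_X) = H¹(Ω³_X) = H^{3,1}`
(one-dimensional): `σ_1ᵗ(η₀) = η₀ ∧ At(E) ∈ Ext²(E, E ⊗ ω_X)`. The linear algebra that turns this
into the computable criterion "semiregular ⇔ `dim Ext² = rank(σ ∘ ev)`" is checked here. -/

variable {K : Type u} [Field K] {H V : Type v} [AddCommGroup H] [Module K H] [AddCommGroup V]
  [Module K V]

/-- If `σ = evᵗ ∘ e` for a duality `e : V ≃ V^∨` then `σ` is injective iff `ev` is surjective
(transpose of a surjection). [folklore] -/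
theorem injective_transpose_iff_surjective (ev : H →ₗ[K] V) (e : V ≃ₗ[K] Module.Dual K V) :
    Function.Injective (ev.dualMap ∘ₗ (e : V →ₗ[K] Module.Dual K V)) ↔ Function.Surjective ev := by
  rw [← LinearMap.dualMap_injective_iff]
  constructor
  · intro h x y hxy
    obtain ⟨x', rfl⟩ := e.surjective x
    obtain ⟨y', rfl⟩ := e.surjective y
    exact congrArg e (h (by simpa using hxy))
  · intro h
    exact h.comp e.injective

/-- **Lemma B, linear-algebra skeleton** (CRUX-ATTACK-g2 §4): with `σ = evᵗ ∘ e`, `E` is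
semiregular iff `dim Ext²(E,E) = rank(σ ∘ ev)`; and `σ ∘ ev` is CONTRACTION WITH THE MUKAI
VECTOR (`⟨ξ, -At⟩ ↦ ⟨ξ, ch⟩`, Buchweitz–Flenner Prop. 4.2 / Cor. 4.3), a matrix one can write down
from `ch(E)` alone — which is what makes "forced kernel" a finite computation per anchor and Mukai
vector (`ρ₂(v)` in g2's scripts; Markman arXiv:2502.03415 Lemma 8.3.4 is the sufficiency half).
[cite: BuchweitzFlenner2003, Prop. 4.2 and Cor. 4.3] -/
theorem injective_transpose_iff_finrank_range [FiniteDimensional K V] (ev : H →ₗ[K] V)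
    (e : V ≃ₗ[K] Module.Dual K V) :
    Function.Injective (ev.dualMap ∘ₗ (e : V →ₗ[K] Module.Dual K V)) ↔
      Module.finrank K (LinearMap.range ((ev.dualMap ∘ₗ (e : V →ₗ[K] Module.Dual K V)) ∘ₗ ev)) =
        Module.finrank K V := by
  rw [injective_transpose_iff_surjective]
  constructor
  · intro hsurj
    have hinj : Function.Injective (ev.dualMap ∘ₗ (e : V →ₗ[K] Module.Dual K V)) :=
      (injective_transpose_iff_surjective ev e).2 hsurj
    rw [LinearMap.range_comp, LinearMap.range_eq_top.2 hsurj, Submodule.map_top]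
    exact LinearMap.finrank_range_of_inj hinj
  · intro heq
    rw [← LinearMap.range_eq_top]
    apply Submodule.eq_top_of_finrank_eq
    apply le_antisymm (Submodule.finrank_le _)
    calc Module.finrank K V
        = Module.finrank K
            (LinearMap.range ((ev.dualMap ∘ₗ (e : V →ₗ[K] Module.Dual K V)) ∘ₗ ev)) := heq.symm
      _ ≤ Module.finrank K (LinearMap.range ev) := by
          rw [LinearMap.range_comp]
          exact Submodule.finrank_map_le _ _

end TransposeCriterion

end Summit.HodgeConjecture.HodgeConjecture.Theorems.SemiregularSeedsOnAnchors.Negative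

end
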